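import Literature.Analysis.OperatorTheory.PositiveKernelSpectralTrace
import Literature.Analysis.OperatorTheory.PositivityImproving
import Literature.Analysis.OperatorTheory.PositiveKernelTransferOperator
import Literature.Analysis.OperatorTheory.HeterogeneousCyclicPeeling
import HarnessLib

/-!
# The twisted trace formula for a symmetric Hilbert–Schmidt kernel and a measure-preserving symmetry

Topic `Literature/Analysis/OperatorTheory`; companion of `PositiveKernelSpectralTrace.lean` (the untwisted trace
formulas `∫ (κ^{[M+1]} K(·,x))(x) dμ = Σᵢ λᵢ^{M+2}` for the cyclic kernel integrals of a bounded symmetric kernel `K`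
on a finite measure space, over an eigenbasis `A bᵢ = λᵢ bᵢ` of its `L²` transfer operator),
`PositivityImproving.lean` (Jentzsch / Perron–Frobenius for positivity-improving operators) and
`HeterogeneousCyclicPeeling.lean` (peeling cyclic chains with a marked bond).  Here a measurable MEASURE-PRESERVING
map `T : X → X` (a «twist»: a symmetry inserted into ONE bond of the cyclic chain — in the time-sliced lattice gauge
theory, 't Hooft's central gauge rotation `Ω[k]` of one time slice, `Literature.MathematicalPhysics.QuantumFieldTheory.finSliceTwist`)
is composed into the chain.  Writing `cᵢ = κ bᵢ = ∫ K(·, z) bᵢ(z) dμ(z)` (honest functions):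

* `hasSum_pow_integral_iterate_twisted` — **twisted trace formula** (`T` measurable, NO invariance needed):
  `∫ (κ^{[M+1]} K(·,x))(T x) dμ(x) = Σᵢ λᵢ^M ∫ cᵢ(T x) cᵢ(x) dμ(x)` — the kernel form of 't Hooft's
  `Tr Ω[k] e^{−βH} = Σ_n e^{−βE_n} ⟨n|Ω[k]|n⟩` ((5.3)), i.e. `Tr(U_T A^{M+2})` expanded in the eigenbasis;
* `abs_integral_twisted_coeff_le` — `|∫ cᵢ∘T · cᵢ dμ| ≤ λᵢ²` for measure-preserving `T` (the Koopman operator of `T` is an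
  isometry; Cauchy–Schwarz): the twisted coefficients `⟨bᵢ, U_T bᵢ⟩` have modulus `≤ 1`;
* `integral_twisted_coeff_top` — **the top state is twist-invariant** (Perron–Frobenius): if `K > 0` pointwise and `K` is
  `T`-invariant then `∫ c_{i₀}∘T · c_{i₀} dμ = λ_{i₀}²` at the top index `λ_{i₀} = ‖A‖ ≠ 0` — 't Hooft's «the vacuum carries
  no electric flux» for a finite transfer matrix: the simple, a.e.-positive top eigenvector is fixed by every positivity- and
  measure-preserving symmetry commuting with `A`;
* `integral_cyclic_twisted_eq_integral_iterate` — the cyclic chain of `1 + M + 1` bonds with the bond `V 0 → V 1` twisted,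
  `K(T V₀, V₁)`, equals the twisted iterate (bridge to the product form a time-slicing theorem delivers, e.g.
  `wilsonFinTorusTwistedPartition_eq_integral_prod_finTorusSliceKernel`); `hasSum_pow_integral_cyclic_one` (untwisted case);
* `integral_iterate_twisted_le`, `integral_cyclic_twisted_le` — **a twist never raises the trace** (`λᵢ ≥ 0`):
  `Z^{tw} ≤ Z` — the transfer-matrix proof of the Tomboulis–Yaffe / Kanazawa inequality `0 ≤ Z^{[k]}/Z ≤ 1`
  (Kanazawa Lemma 2 (17), there by reflection positivity) for any positive-type kernel chain.

Provenance: typed and kernel-checked by the ideator seat `ym-ir-idea-9` (g2) as §4 of the crux workfile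
`Summits/QuantumFields/YangMills/Cruxes/IR/Lines/flux_purity_square_seam.lean` (rev 4, commit f7a9f65e6941); landed here
verbatim (namespace and citations only) so that it is importable.  Everything is PROVED; Mathlib + the companion files only;
no definitions.

References: G. 't Hooft, Nucl. Phys. B 153 (1979) 141, §§4–5; M. Reed, B. Simon, *Methods of Modern Mathematical Physics*
I (1980) Thm. VI.22–23, IV (1978) Thm. XIII.43–44; T. Kanazawa, Ann. Phys. 324 (2009) 1634 (arXiv:0808.3442) §2 Lemma 2;
E. T. Tomboulis, L. G. Yaffe, Commun. Math. Phys. 100 (1985) 313.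
-/

noncomputable section

namespace Literature.Analysis.OperatorTheory

section Kernel

open MeasureTheory Filter Set Function
open scoped RealInnerProductSpace ENNReal


variable {X : Type*} [MeasurableSpace X] {μ : Measure X} [IsFiniteMeasure μ]
  {K : X → X → ℝ} {C : ℝ} {A : Lp ℝ 2 μ →L[ℝ] Lp ℝ 2 μ} {ι : Type*}
  {b : HilbertBasis ι ℝ (Lp ℝ 2 μ)} {lam : ι → ℝ}

/-- **Twisted trace formula.**  For a measure-preserving `T`,
`∫ (κ^{[M+1]} K(·,x))(T x) dμ(x) = Σᵢ λᵢ^M ∫ (κbᵢ)(T x) (κbᵢ)(x) dμ(x)`.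
[cite: tHooft1979Flux, §5 (5.3)] [cite: ReedSimonI1980, Thm. VI.22–23] -/
theorem hasSum_pow_integral_iterate_twisted [Countable ι] (hK : StronglyMeasurable (uncurry K))
    (hC : ∀ x y, ‖K x y‖ ≤ C) (hsymm : ∀ x y, K x y = K y x)
    (hA : ∀ φ : Lp ℝ 2 μ, (A φ : X → ℝ) =ᵐ[μ] fun x => ∫ y, K x y * φ y ∂μ)
    (hb : ∀ i, A (b i) = lam i • b i) {T : X → X} (hTm : Measurable T) (M : ℕ) :
    HasSum (fun i => lam i ^ M * ∫ x, (∫ z, K (T x) z * b i z ∂μ) * (∫ z, K x z * b i z ∂μ) ∂μ)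
      (∫ x, ((fun f : X → ℝ => fun w => ∫ z, K w z * f z ∂μ)^[M + 1] (fun z => K z x)) (T x) ∂μ) := by
  set κ : (X → ℝ) → X → ℝ := fun f w => ∫ z, K w z * f z ∂μ with hκ
  set c : ι → X → ℝ := fun i x => ∫ z, K x z * b i z ∂μ with hc
  have hcm : ∀ i, Measurable (c i) := fun i => measurable_integral_kernel_mul_basis hK b i
  have hlamA : ∀ i, |lam i| ≤ ‖A‖ := abs_lam_le_norm hb
  have hpars : ∀ x, Summable (fun i => c i x ^ 2) ∧ ∑' i, c i x ^ 2 ≤ C ^ 2 * μ.real univ :=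
    fun x => tsum_sq_integral_kernel_mul_le hK hC b x
  have hsq_meas : Measurable fun x => ∫ z, ‖K x z‖ ^ 2 ∂μ :=
    (stronglyMeasurable_integral_norm_kernel_sq hK).measurable
  have hsq_eq : ∀ x, ∑' i, c i x ^ 2 = ∫ z, ‖K x z‖ ^ 2 ∂μ := fun x =>
    (hasSum_norm_sq_integral_kernel_mul (𝕜 := ℝ) hK hC b x |>.tsum_eq |> fun h => by
      simpa only [Real.norm_eq_abs, sq_abs] using h)
  -- (0) pointwise expansion at the pair `(T x, x)`
  have hpt : ∀ x, HasSum (fun i => lam i ^ M * c i (T x) * c i x) ((κ^[M + 1] (fun z => K z x)) (T x)) :=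
    fun x => by
    rw [iterate_kernel_eq_inner hK hC hsymm hA M (T x) x]
    exact hasSum_inner_kernel_section_pow hK hC hsymm hA hb M (T x) x
  -- (1) sum and `x`-integral commute (dominated convergence)
  have key := hasSum_integral_of_dominated_convergence (μ := μ)
    (F := fun i x => lam i ^ M * c i (T x) * c i x)
    (f := fun x => (κ^[M + 1] (fun z => K z x)) (T x))
    (fun i x => ‖A‖ ^ M * ((c i (T x) ^ 2 + c i x ^ 2) / 2)) (fun i => ?_) (fun i => ?_) ?_ ?_
    (Eventually.of_forall hpt)
  · refine key.congr_fun fun i => ?_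
    rw [← integral_const_mul]
    exact integral_congr_ae (Eventually.of_forall fun x => by simp only [hc]; ring)
  · exact ((((hcm i).comp hTm).const_mul _).mul (hcm i)).aestronglyMeasurable
  · refine Eventually.of_forall fun x => ?_
    rw [Real.norm_eq_abs, abs_mul, abs_mul, abs_pow]
    have h2 : |lam i| ^ M ≤ ‖A‖ ^ M := pow_le_pow_left₀ (abs_nonneg _) (hlamA i) M
    have h3 : |c i (T x)| * |c i x| ≤ (c i (T x) ^ 2 + c i x ^ 2) / 2 := by
      have hsq := two_mul_le_add_sq |c i (T x)| |c i x|
      rw [sq_abs, sq_abs] at hsq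
      linarith
    calc |lam i| ^ M * |c i (T x)| * |c i x| = |lam i| ^ M * (|c i (T x)| * |c i x|) := by ring
      _ ≤ ‖A‖ ^ M * ((c i (T x) ^ 2 + c i x ^ 2) / 2) := by gcongr
  · exact Eventually.of_forall fun x => (((hpars (T x)).1.add (hpars x).1).div_const 2).mul_left _
  · have hfun : (fun x => ∑' i, ‖A‖ ^ M * ((c i (T x) ^ 2 + c i x ^ 2) / 2)) =
        fun x => ‖A‖ ^ M * ((∫ z, ‖K (T x) z‖ ^ 2 ∂μ + ∫ z, ‖K x z‖ ^ 2 ∂μ) / 2) := by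
      funext x
      rw [tsum_mul_left, tsum_div_const, (hpars (T x)).1.tsum_add (hpars x).1, hsq_eq (T x), hsq_eq x]
    rw [hfun]
    have hbd : ∀ y, ‖∫ z, ‖K y z‖ ^ 2 ∂μ‖ ≤ C ^ 2 * μ.real univ := fun y => by
      rw [Real.norm_eq_abs, abs_of_nonneg (integral_nonneg fun z => by positivity), ← hsq_eq y]
      exact (hpars y).2
    exact ((Integrable.of_bound (hsq_meas.comp hTm).aestronglyMeasurable (C ^ 2 * μ.real univ)
        (Eventually.of_forall fun x => hbd (T x))).add
      (Integrable.of_bound hsq_meas.aestronglyMeasurable (C ^ 2 * μ.real univ)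
        (Eventually.of_forall fun x => hbd x))).div_const 2 |>.const_mul _

/-- **The twisted coefficients are bounded by the untwisted ones**: `|∫ (κbᵢ)(T x)(κbᵢ)(x) dμ| ≤ λᵢ²`
for a measure-preserving `T` (Cauchy–Schwarz in the form `|uv| ≤ (u²+v²)/2` plus `∫ (κbᵢ∘T)² = ∫ (κbᵢ)² = λᵢ²`).
[cite: ReedSimonI1980, Thm. VI.22–23] -/
theorem abs_integral_twisted_coeff_le (hK : StronglyMeasurable (uncurry K)) (hC : ∀ x y, ‖K x y‖ ≤ C)
    (hA : ∀ φ : Lp ℝ 2 μ, (A φ : X → ℝ) =ᵐ[μ] fun x => ∫ y, K x y * φ y ∂μ)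
    (hb : ∀ i, A (b i) = lam i • b i) {T : X → X} (hT : MeasurePreserving T μ μ) (i : ι) :
    |∫ x, (∫ z, K (T x) z * b i z ∂μ) * (∫ z, K x z * b i z ∂μ) ∂μ| ≤ lam i ^ 2 := by
  set c : X → ℝ := fun x => ∫ z, K x z * b i z ∂μ with hc
  have hcm : Measurable c := measurable_integral_kernel_mul_basis hK b i
  have hTm : Measurable T := hT.measurable
  have hpars : ∀ x, Summable (fun j => (∫ z, K x z * b j z ∂μ) ^ 2) ∧
      ∑' j, (∫ z, K x z * b j z ∂μ) ^ 2 ≤ C ^ 2 * μ.real univ :=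
    fun x => tsum_sq_integral_kernel_mul_le hK hC b x
  have hcb : ∀ x, c x ^ 2 ≤ C ^ 2 * μ.real univ := fun x =>
    ((hpars x).1.le_tsum i fun j _ => sq_nonneg _).trans (hpars x).2
  -- integrability of the three bounded measurable functions involved
  have hint_sq : Integrable (fun x => c x ^ 2) μ :=
    Integrable.of_bound (hcm.pow_const 2).aestronglyMeasurable (C ^ 2 * μ.real univ)
      (Eventually.of_forall fun x => by
        rw [Real.norm_eq_abs, abs_of_nonneg (sq_nonneg _)]; exact hcb x)
  have hint_sqT : Integrable (fun x => c (T x) ^ 2) μ :=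
    Integrable.of_bound ((hcm.comp hTm).pow_const 2).aestronglyMeasurable (C ^ 2 * μ.real univ)
      (Eventually.of_forall fun x => by
        rw [Real.norm_eq_abs, abs_of_nonneg (sq_nonneg _)]; exact hcb (T x))
  have hdom : ∀ x, |c (T x) * c x| ≤ (c (T x) ^ 2 + c x ^ 2) / 2 := fun x => by
    rw [abs_mul]
    have hsq := two_mul_le_add_sq |c (T x)| |c x|
    rw [sq_abs, sq_abs] at hsq
    linarith
  -- `∫ (c∘T)² = ∫ c²` by measure preservation
  have hcomp : ∫ x, c (T x) ^ 2 ∂μ = ∫ x, c x ^ 2 ∂μ := by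
    have h := integral_map (μ := μ) hTm.aemeasurable (f := fun y => c y ^ 2)
      ((hcm.pow_const 2).aestronglyMeasurable)
    rw [hT.map_eq] at h
    exact h.symm
  have hsqlam : ∫ x, c x ^ 2 ∂μ = lam i ^ 2 := integral_sq_integral_kernel_mul_basis hK hC hA hb i
  calc |∫ x, c (T x) * c x ∂μ| ≤ ∫ x, |c (T x) * c x| ∂μ := by
        rw [← Real.norm_eq_abs]
        exact (norm_integral_le_integral_norm _).trans (le_of_eq (by simp only [Real.norm_eq_abs]))
    _ ≤ ∫ x, (c (T x) ^ 2 + c x ^ 2) / 2 ∂μ := by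
        refine integral_mono_of_nonneg (Eventually.of_forall fun x => abs_nonneg _)
          ((hint_sqT.add hint_sq).div_const 2) (Eventually.of_forall hdom)
    _ = (∫ x, c (T x) ^ 2 ∂μ + ∫ x, c x ^ 2 ∂μ) / 2 := by
        rw [MeasureTheory.integral_div, integral_add hint_sqT hint_sq]
    _ = lam i ^ 2 := by rw [hcomp, hsqlam]; ring

/-- **Flux-free top state (Perron–Frobenius).**  If moreover `K > 0` pointwise (so its transfer operator is
positivity improving) and `K` is `T`-INVARIANT, `K (T x) (T y) = K x y`, then the top twisted coefficient
equals the untwisted one: `∫ (κb₀)(T x) (κb₀)(x) dμ = λ₀²` for every index `i₀` with `λ_{i₀} = ‖A‖ ≠ 0`.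
Proof: `κb₀ = λ₀ b₀` spans the (simple) top eigenspace, generated by an a.e.-positive `φ`; `(κb₀)∘T` is again a
top eigenfunction (invariance + measure preservation), hence a multiple of `φ`; comparing with
`(κb₀)∘T = a'·(φ∘T)` a.e. and `∫ φ·(φ∘T) > 0` fixes the sign, and `‖(κb₀)∘T‖ = ‖κb₀‖` the modulus.
[cite: ReedSimonIV1978, Thm XIII.43 and Thm XIII.44] [cite: tHooft1979Flux, §4 (4.3)–(4.5)] -/
theorem integral_twisted_coeff_top (hK : StronglyMeasurable (uncurry K)) (hC : ∀ x y, ‖K x y‖ ≤ C)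
    (hsymm : ∀ x y, K x y = K y x) (hKpos : ∀ x y, 0 < K x y)
    (hA : ∀ φ : Lp ℝ 2 μ, (A φ : X → ℝ) =ᵐ[μ] fun x => ∫ y, K x y * φ y ∂μ)
    (hb : ∀ i, A (b i) = lam i • b i) {T : X → X} (hT : MeasurePreserving T μ μ)
    (hKT : ∀ x y, K (T x) (T y) = K x y) {i₀ : ι} (hi₀ : lam i₀ = ‖A‖) (hlam₀ : lam i₀ ≠ 0) :
    ∫ x, (∫ z, K (T x) z * b i₀ z ∂μ) * (∫ z, K x z * b i₀ z ∂μ) ∂μ = lam i₀ ^ 2 := by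
  set c : X → ℝ := fun x => ∫ z, K x z * b i₀ z ∂μ with hc
  have hcm : Measurable c := measurable_integral_kernel_mul_basis hK b i₀
  have hTm : Measurable T := hT.measurable
  have hqmp : Measure.QuasiMeasurePreserving T μ μ := hT.quasiMeasurePreserving
  -- (1) `c = λ₀ b₀` a.e.
  have hĉeq : ((memLp_two_integral_kernel_mul hK hC (b i₀)).toLp _ : Lp ℝ 2 μ) = lam i₀ • b i₀ := by
    rw [← apply_basis_eq_toLp hK hC hA b i₀, hb]
  have hcae : c =ᵐ[μ] fun x => lam i₀ * b i₀ x := by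
    have h2 := (memLp_two_integral_kernel_mul hK hC (b i₀)).coeFn_toLp
    rw [hĉeq] at h2
    filter_upwards [h2, Lp.coeFn_smul (lam i₀) (b i₀ : Lp ℝ 2 μ)] with x hx hs
    rw [hs, Pi.smul_apply, smul_eq_mul] at hx
    exact hx.symm
  -- (2) `κ c = λ₀ c` everywhere
  have hκc : ∀ u, ∫ y, K u y * c y ∂μ = lam i₀ * c u := by
    intro u
    calc ∫ y, K u y * c y ∂μ = ∫ y, K u y * (lam i₀ * b i₀ y) ∂μ :=
          integral_congr_ae (by filter_upwards [hcae] with y hy; rw [hy])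
      _ = lam i₀ * ∫ y, K u y * b i₀ y ∂μ := by
          rw [← integral_const_mul]
          exact integral_congr_ae (Eventually.of_forall fun y => by ring)
      _ = lam i₀ * c u := rfl
  -- (3) `κ (c ∘ T) = λ₀ (c ∘ T)` everywhere (invariance + measure preservation)
  have hκg : ∀ x, ∫ y, K x y * c (T y) ∂μ = lam i₀ * c (T x) := by
    intro x
    have h1 : (fun y => K x y * c (T y)) = fun y => (fun u => K (T x) u * c u) (T y) := by
      funext y
      show K x y * c (T y) = K (T x) (T y) * c (T y)
      rw [hKT x y]
    have h2 : ∫ y, (fun u => K (T x) u * c u) (T y) ∂μ = ∫ u, K (T x) u * c u ∂μ := by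
      have := integral_map (μ := μ) hTm.aemeasurable (f := fun u => K (T x) u * c u)
        (((hK.measurable.of_uncurry_left (x := T x)).mul hcm).aestronglyMeasurable)
      rw [hT.map_eq] at this
      exact this.symm
    rw [h1, h2, hκc (T x)]
  -- (4) the `L²` classes `ĉ` of `c` and `ĝ` of `c ∘ T`, both top eigenvectors
  have hg_mem : MemLp (fun x => c (T x)) 2 μ := by
    refine MemLp.of_bound (hcm.comp hTm).aestronglyMeasurable
      (C * Real.sqrt (μ.real univ) * ‖(b i₀ : Lp ℝ 2 μ)‖) (Eventually.of_forall fun x => ?_)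
    rw [Real.norm_eq_abs]
    exact abs_integral_kernel_mul_le hC ((norm_nonneg _).trans (hC x x)) (b i₀) (T x)
  set ĝ : Lp ℝ 2 μ := hg_mem.toLp _ with hĝ
  have hĝae : (ĝ : X → ℝ) =ᵐ[μ] fun x => c (T x) := hg_mem.coeFn_toLp
  set ĉ : Lp ℝ 2 μ := (memLp_two_integral_kernel_mul hK hC (b i₀)).toLp _ with hĉ
  have hĉae : (ĉ : X → ℝ) =ᵐ[μ] c := (memLp_two_integral_kernel_mul hK hC (b i₀)).coeFn_toLp
  have hAĝ : A ĝ = ‖A‖ • ĝ := by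
    refine Lp.ext ?_
    filter_upwards [hA ĝ, hĝae, Lp.coeFn_smul ‖A‖ ĝ] with x hx hgx hsx
    rw [hx, hsx, Pi.smul_apply, smul_eq_mul, hgx, ← hi₀, ← hκg x]
    exact integral_congr_ae (by filter_upwards [hĝae] with y hy; rw [hy])
  have hAĉ : A ĉ = ‖A‖ • ĉ := by
    rw [hĉeq, map_smul, hb, hi₀]
  have hĉne : ĉ ≠ 0 := by
    rw [hĉeq]
    exact smul_ne_zero hlam₀ (b.orthonormal.ne_zero i₀)
  have hμ : μ ≠ 0 := measure_ne_zero_of_ne_zero hĉne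
  -- (5) Perron–Frobenius: the top eigenspace is spanned by an a.e.-positive unit vector `φ`
  have hsa := isSelfAdjoint_kernelOp hK hC hsymm hA
  have hImp := isPositivityImproving_kernelOp hK hC hKpos hA
  obtain ⟨φ, hφ1, hφpos, -, hspan⟩ := hImp.simple_top_eigenvalue hsa ⟨ĉ, hĉne, hAĉ⟩
  have hĉφ : ĉ = ⟪φ, ĉ⟫ • φ := hspan ĉ hAĉ
  have hĝφ : ĝ = ⟪φ, ĝ⟫ • φ := hspan ĝ hAĝ
  set a' : ℝ := ⟪φ, ĉ⟫ with ha'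
  set a : ℝ := ⟪φ, ĝ⟫ with ha
  -- (6) the integral is `⟪ĝ, ĉ⟫ = a a'`
  have hint : ∫ x, c (T x) * c x ∂μ = ⟪ĝ, ĉ⟫ := by
    rw [inner_eq_integral]
    exact integral_congr_ae (by filter_upwards [hĝae, hĉae] with x h1 h2; rw [h1, h2])
  have hinner : ⟪ĝ, ĉ⟫ = a * a' := by
    rw [hĝφ, hĉφ, real_inner_smul_left, real_inner_smul_right, real_inner_self_eq_norm_sq, hφ1]
    ring
  -- (7) moduli: `|a'| = |a| = |λ₀|`
  have hnorm_smul : ∀ r : ℝ, ‖r • φ‖ = |r| := fun r => by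
    rw [norm_smul, Real.norm_eq_abs, hφ1, mul_one]
  have habs_a' : |a'| = |lam i₀| := by
    rw [← hnorm_smul, ← hĉφ, hĉeq, norm_smul, Real.norm_eq_abs, b.orthonormal.norm_eq_one i₀, mul_one]
  have hcomp : ∫ x, c (T x) ^ 2 ∂μ = ∫ x, c x ^ 2 ∂μ := by
    have h := integral_map (μ := μ) hTm.aemeasurable (f := fun y => c y ^ 2)
      ((hcm.pow_const 2).aestronglyMeasurable)
    rw [hT.map_eq] at h
    exact h.symm
  have hĝnorm : ‖ĝ‖ ^ 2 = lam i₀ ^ 2 := by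
    rw [hĝ, norm_toLp_sq_eq_integral_norm_sq (𝕜 := ℝ)]
    simp only [Real.norm_eq_abs, sq_abs]
    rw [hcomp, integral_sq_integral_kernel_mul_basis hK hC hA hb i₀]
  have habs_a : |a| = |lam i₀| := by
    have h1 : |a| = ‖ĝ‖ := by rw [← hnorm_smul, ← hĝφ]
    rw [h1]
    exact (sq_eq_sq₀ (norm_nonneg _) (abs_nonneg _)).1 (by rw [hĝnorm, sq_abs])
  -- (8) sign: `a = a' · ∫ φ (φ∘T)` and `∫ φ (φ∘T) > 0`
  have hφT_mem : MemLp ((φ : X → ℝ) ∘ T) 2 μ := (Lp.memLp φ).comp_measurePreserving hT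
  set φT : Lp ℝ 2 μ := hφT_mem.toLp _ with hφT
  have hφTae : (φT : X → ℝ) =ᵐ[μ] (φ : X → ℝ) ∘ T := hφT_mem.coeFn_toLp
  have hφTpos : IsStrictlyPositiveFun φT := by
    unfold IsStrictlyPositiveFun
    filter_upwards [hφTae, hqmp.ae hφpos] with x hx hpx
    rw [hx]
    exact hpx
  have hP : 0 < ⟪φT, φ⟫ := inner_pos (hφTpos.isPositiveFun hμ) hφpos
  have hPint : ⟪φT, φ⟫ = ∫ x, φ (T x) * φ x ∂μ := by
    rw [inner_eq_integral]
    exact integral_congr_ae (by filter_upwards [hφTae] with x hx; rw [hx, Function.comp_apply])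
  have hcTae : (fun x => c (T x)) =ᵐ[μ] fun x => a' * φ (T x) := by
    have h1 : c =ᵐ[μ] fun x => a' * φ x := by
      have h2 : ((a' • φ : Lp ℝ 2 μ) : X → ℝ) =ᵐ[μ] c := by rw [← hĉφ]; exact hĉae
      filter_upwards [h2, Lp.coeFn_smul a' φ] with x hx hs
      rw [← hx, hs, Pi.smul_apply, smul_eq_mul]
    exact hqmp.ae_eq_comp h1
  have ha_eq : a = a' * ⟪φT, φ⟫ := by
    rw [hPint, ha, inner_eq_integral, ← integral_const_mul]
    refine integral_congr_ae ?_
    filter_upwards [hĝae, hcTae] with x h1 h2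
    rw [h1, h2]
    ring
  -- (9) conclusion
  have hprod_nonneg : 0 ≤ a * a' := by
    rw [ha_eq]
    have : a' * ⟪φT, φ⟫ * a' = a' ^ 2 * ⟪φT, φ⟫ := by ring
    rw [this]
    positivity
  rw [hint, hinner, ← abs_of_nonneg hprod_nonneg, abs_mul, habs_a, habs_a', ← sq, sq_abs]

omit [IsFiniteMeasure μ] in
/-- **Cyclic (path-integral) form of the twisted trace.**  The periodic chain of `M + 2` slice kernels whose closing
bond `V 0 → V 1` is twisted, `K (T (V 0)) (V 1)`, equals the twisted diagonal iterate `∫ (κ^{[M+1]} K(·,x))(T x) dμ(x)`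
(the shape a twisted time-slicing theorem «`Z^{(c)} = ∫ ∏ₜ Kₜ(V t, V (t+1))`, `K₀ = K(T_c ·, ·)`» delivers;
`Literature.Analysis.OperatorTheory.integral_cyclic_insert_one` with the bond kernel `X = K(T·, ·)`).
[cite: tHooft1979Flux, §5 (5.3)–(5.4)] -/
theorem integral_cyclic_twisted_eq_integral_iterate [IsFiniteMeasure μ] (hK : StronglyMeasurable (uncurry K))
    (hC : ∀ x y, ‖K x y‖ ≤ C) {T : X → X} (hTm : Measurable T) (M : ℕ) :
    ∫ V : Fin (1 + M + 1) → X, K (T (V 0)) (V 1) * ∏ t : Fin (1 + M), K (V t.succ) (V (t.succ + 1))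
        ∂(Measure.pi fun _ => μ) =
      ∫ x, ((fun f : X → ℝ => fun w => ∫ y, K w y * f y ∂μ)^[M + 1] (fun y => K y x)) (T x) ∂μ := by
  have hX : Measurable (uncurry fun x y => K (T x) y) := by
    have h : (uncurry fun x y => K (T x) y) = uncurry K ∘ Prod.map T id := by
      funext p; rfl
    rw [h]
    exact hK.measurable.comp (hTm.prodMap measurable_id)
  rw [integral_cyclic_insert_one (ρ := μ) (X := fun x y => K (T x) y) (K := K) hX hK.measurable
    (fun x y => hC (T x) y) hC M]
  refine integral_congr_ae (Eventually.of_forall fun x => ?_)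
  dsimp only
  rw [Function.iterate_succ_apply']

/-- **Untwisted trace formula in the one-marked-bond convention**: `Σ λᵢ^{M+2} = ∫ K(V₀,V₁) ∏ K(V_{t+1},V_{t+2}) dV` over
`Fin (1+M+1)` (the `T = id` case of `hasSum_pow_integral_iterate_twisted` + the cyclic bridge; used to identify the untwisted
member of a sliced twisted family with the partition function).
[cite: ReedSimonI1980, Thm. VI.22–23] -/
theorem hasSum_pow_integral_cyclic_one [Countable ι] (hK : StronglyMeasurable (uncurry K))
    (hC : ∀ x y, ‖K x y‖ ≤ C) (hsymm : ∀ x y, K x y = K y x)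
    (hA : ∀ φ : Lp ℝ 2 μ, (A φ : X → ℝ) =ᵐ[μ] fun x => ∫ y, K x y * φ y ∂μ)
    (hb : ∀ i, A (b i) = lam i • b i) (M : ℕ) :
    HasSum (fun i => lam i ^ (M + 2))
      (∫ V : Fin (1 + M + 1) → X, K (V 0) (V 1) * ∏ t : Fin (1 + M), K (V t.succ) (V (t.succ + 1))
        ∂(Measure.pi fun _ => μ)) := by
  have h := hasSum_pow_integral_iterate_twisted hK hC hsymm hA hb measurable_id M
  have hbr := integral_cyclic_twisted_eq_integral_iterate (μ := μ) hK hC (T := id) measurable_id M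
  simp only [id_eq] at h hbr
  have hco : ∀ i, ∫ x, (∫ z, K x z * b i z ∂μ) * (∫ z, K x z * b i z ∂μ) ∂μ = lam i ^ 2 := fun i => by
    rw [← integral_sq_integral_kernel_mul_basis hK hC hA hb i]
    exact integral_congr_ae (Eventually.of_forall fun x => (sq _).symm)
  have hfun : (fun i => lam i ^ M * ∫ x, (∫ z, K x z * b i z ∂μ) * (∫ z, K x z * b i z ∂μ) ∂μ) =
      fun i => lam i ^ (M + 2) := funext fun i => by rw [hco, pow_add]
  rw [hfun] at h
  rwa [hbr]

/-- **A twist never raises the trace**: `∫ (κ^{[M+1]}K(·,x))(T x) dμ ≤ ∫ (κ^{[M+1]}K(·,x))(x) dμ` for a measure-preserving `T`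
(`λᵢ ≥ 0`, `|∫ (κbᵢ)∘T·κbᵢ| ≤ λᵢ² = ∫ (κbᵢ)²`; i.e. `Z^{tw} ≤ Z`, `|κᵢ(c)| ≤ 1`).
[cite: Kanazawa2008, §2 Lemma 2 eq. (17)] [cite: tHooft1979Flux, §5 (5.3)] -/
theorem integral_iterate_twisted_le [Countable ι] (hK : StronglyMeasurable (uncurry K))
    (hC : ∀ x y, ‖K x y‖ ≤ C) (hsymm : ∀ x y, K x y = K y x)
    (hA : ∀ φ : Lp ℝ 2 μ, (A φ : X → ℝ) =ᵐ[μ] fun x => ∫ y, K x y * φ y ∂μ)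
    (hb : ∀ i, A (b i) = lam i • b i) (hlam : ∀ i, 0 ≤ lam i) {T : X → X} (hT : MeasurePreserving T μ μ)
    (M : ℕ) :
    ∫ x, ((fun f : X → ℝ => fun w => ∫ z, K w z * f z ∂μ)^[M + 1] (fun z => K z x)) (T x) ∂μ ≤
      ∫ x, ((fun f : X → ℝ => fun w => ∫ z, K w z * f z ∂μ)^[M + 1] (fun z => K z x)) x ∂μ := by
  have h1 := hasSum_pow_integral_iterate_twisted hK hC hsymm hA hb hT.measurable M
  have h2 := hasSum_pow_integral_iterate_twisted hK hC hsymm hA hb measurable_id M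
  simp only [id_eq] at h2
  refine hasSum_le (fun i => ?_) h1 h2
  have hco : ∫ x, (∫ z, K x z * b i z ∂μ) * (∫ z, K x z * b i z ∂μ) ∂μ = lam i ^ 2 := by
    rw [← integral_sq_integral_kernel_mul_basis hK hC hA hb i]
    exact integral_congr_ae (Eventually.of_forall fun x => (sq _).symm)
  rw [hco]
  exact mul_le_mul_of_nonneg_left ((le_abs_self _).trans (abs_integral_twisted_coeff_le hK hC hA hb hT i))
    (pow_nonneg (hlam i) M)

/-- Cyclic-chain form of `integral_iterate_twisted_le`: twisting the closing bond never raises the chain integral.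
[cite: Kanazawa2008, §2 Lemma 2 eq. (17)] -/
theorem integral_cyclic_twisted_le [Countable ι] (hK : StronglyMeasurable (uncurry K))
    (hC : ∀ x y, ‖K x y‖ ≤ C) (hsymm : ∀ x y, K x y = K y x)
    (hA : ∀ φ : Lp ℝ 2 μ, (A φ : X → ℝ) =ᵐ[μ] fun x => ∫ y, K x y * φ y ∂μ)
    (hb : ∀ i, A (b i) = lam i • b i) (hlam : ∀ i, 0 ≤ lam i) {T : X → X} (hT : MeasurePreserving T μ μ)
    (M : ℕ) :
    ∫ V : Fin (1 + M + 1) → X, K (T (V 0)) (V 1) * ∏ t : Fin (1 + M), K (V t.succ) (V (t.succ + 1))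
        ∂(Measure.pi fun _ => μ) ≤
      ∫ V : Fin (1 + M + 1) → X, K (V 0) (V 1) * ∏ t : Fin (1 + M), K (V t.succ) (V (t.succ + 1))
        ∂(Measure.pi fun _ => μ) := by
  have hbr := integral_cyclic_twisted_eq_integral_iterate (μ := μ) hK hC (T := id) measurable_id M
  simp only [id_eq] at hbr
  rw [integral_cyclic_twisted_eq_integral_iterate (μ := μ) hK hC hT.measurable M, hbr]
  exact integral_iterate_twisted_le hK hC hsymm hA hb hlam hT M

end Kernel

end Literature.Analysis.OperatorTheory

end
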